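import Summits.ValiantsHypothesis.ValiantsHypothesis.Theorems.LacunarySymmetroidMatrixDescartesCensusDoorA34SheetWindowOrdered

/-!
# `MatrixDescartes` census — DOOR A at `(3,4)`: window-ordered supports, SEMIDEFINITE top cell — a null-top eighteen with `adj S₃ ⪰ 0` (e.g. `S₃ ⪰ 0` or `⪯ 0`)
# has a NON-DEFINITE THIRD letter `S₂`, on every support with `3·d₂ < d₃`

HONEST FRAMING.  Object-search cell `pub-symmetroid`, engine seat `val-sym-eng-2` (g4); helper row beside the registered strata line
`Cruxes/DoorA34/Lines/strata.lean` on stmt-ValiantsHypothesis-19980 (`DoorA34 = PosRootLawAt 3 4 18`: OPEN, typed, never asserted here).  Companion of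
…SheetWindowOrdered (indefinite top cell ⇒ non-definite BOTTOM letter): three more chamber-free sheet ranks on a window-ordered support,
`ρ(3d₂) = 9`, `ρ(d₃ + 2d₂) = 15`, `ρ(2d₃ + d₂) = 18`, give the TOP TEST of the THIRD letter `W₂ = (9+15) % 2 + (15+18) % 2 = 1`, which the SEMIDEFINITE adjugate
cell (`adj S₃ ⪰ 0`, in particular `S₃ ⪰ 0` or `S₃ ⪯ 0` by `Census.adjugate_posSemidef_of_semidef_cell`) forbids for a definite `S₂`:

* `sym_sum_lt_topCore_iff`-type block bounds (`sym_sum_lt_three_d2`, `sym_sum_ge_three_d2`, `sym_sum_lt_midTop`, `sym_sum_ge_midTop`);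
* `sheetRank_coreTop/_midTop/_top_of_windowOrdered` (`9 / 15 / 18`);
* **`card_posRoots_le_17_of_windowOrdered_semidefTop_definiteThird`** — `StrictMono d`, `3·d 2 < d 3`, `det S₃ = 0`, `adj S₃ ⪰ 0`, `S₂` definite ⇒ `Z₊ ≤ 17`;
  `card_posRoots_le_17_of_windowOrdered_semidefLetter_definiteThird` — the same with the letter-level cell `S₃ ⪰ 0 ∨ −S₃ ⪰ 0`.

Together with …SheetWindowOrdered: on the whole hierarchical regime a null-top eighteen has `S₀` non-definite (indefinite top) or `S₂` non-definite (semidefinite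
top).  Nothing here bounds anything else; `DoorA34` and the three stubs stay OPEN; registers unchanged; nothing on `MatrixDescartes` (stmt-ValiantsHypothesis-18050)
or `VP ≠ VNP` — VP≠VNP not moved.  [folklore] Descartes (sharp case) bookkeeping; elementary.
-/

-- `Summit.ValiantsHypothesis.ValiantsHypothesis.…` repeats a component by the D-0017 layout
-- (single-conjunct summit), which the `dupNamespace` linter flags; the name is mandated.
set_option linter.dupNamespace false

namespace Summit.ValiantsHypothesis.ValiantsHypothesis.Theorems.LacunarySymmetroidMatrixDescartes.Census

open Polynomial Finset Matrix
open scoped BigOperators Polynomial Matrix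

/-! ## 1. Block bounds around `3d₂` and `d₃ + 2d₂` -/

/-- A slot without the top letter and different from `{2,2,2}` has exponent `< 3d₂`. [folklore] -/
theorem sym_sum_lt_three_d2 (d : Fin 4 → ℕ) (hd : StrictMono d) (s : Sym (Fin 4) 3) (h3 : (3 : Fin 4) ∉ (s : Multiset (Fin 4)))
    (h2 : s ≠ Sym.replicate 3 2) : ((s : Multiset (Fin 4)).map d).sum < 3 * d 2 := by
  have h12 : d 1 < d 2 := hd (by decide)
  have hle2 : ∀ l : Fin 4, l ≠ 3 → d l ≤ d 2 := fun l hl => hd.monotone (by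
    have : (l : ℕ) ≠ 3 := fun h => hl (Fin.ext h)
    have := l.2; show (l : ℕ) ≤ 2; omega)
  have hle1 : ∀ l : Fin 4, l ≠ 3 → l ≠ 2 → d l ≤ d 1 := fun l hl hl2 => hd.monotone (by
    have : (l : ℕ) ≠ 3 := fun h => hl (Fin.ext h)
    have : (l : ℕ) ≠ 2 := fun h => hl2 (Fin.ext h)
    have := l.2; show (l : ℕ) ≤ 1; omega)
  obtain ⟨a, ha, ha2⟩ : ∃ a ∈ (s : Multiset (Fin 4)), a ≠ 2 := by
    by_contra hall
    exact h2 (Sym.eq_replicate_iff.2 fun b hb => by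
      by_contra hb2
      exact hall ⟨b, hb, hb2⟩)
  have ha3 : a ≠ 3 := fun h => h3 (h ▸ ha)
  obtain ⟨t, ht⟩ := Multiset.exists_cons_of_mem ha
  have hct : Multiset.card t = 2 := by
    have hcs : Multiset.card (s : Multiset (Fin 4)) = 3 := Sym.card_coe
    rw [ht, Multiset.card_cons] at hcs; omega
  have h3t : (3 : Fin 4) ∉ t := fun h => h3 (by rw [ht]; exact Multiset.mem_cons_of_mem h)
  have hsum : (t.map d).sum ≤ 2 * d 2 := by
    have h := Multiset.sum_le_card_nsmul (t.map d) (d 2) (by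
      intro x hx
      obtain ⟨l, hl, rfl⟩ := Multiset.mem_map.mp hx
      exact hle2 l (fun h => h3t (h ▸ hl)))
    simpa [hct] using h
  have hda : d a ≤ d 1 := hle1 a ha3 ha2
  rw [ht, Multiset.map_cons, Multiset.sum_cons]; omega

/-- On a window-ordered support a slot containing the top letter, or equal to `{2,2,2}`, has exponent `≥ 3d₂`. [folklore] -/
theorem sym_sum_ge_three_d2 (d : Fin 4 → ℕ) (hd : StrictMono d) (hwin : 3 * d 2 < d 3) (s : Sym (Fin 4) 3)
    (h : (3 : Fin 4) ∈ (s : Multiset (Fin 4)) ∨ s = Sym.replicate 3 2) : 3 * d 2 ≤ ((s : Multiset (Fin 4)).map d).sum := by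
  rcases h with h | h
  · have := sym_sum_ge_mid_of_top_mem d hd s h; omega
  · subst h
    simp only [Sym.coe_replicate, Multiset.map_replicate, Multiset.sum_replicate, smul_eq_mul]; exact le_refl _

/-- A slot with exactly one top letter and different from `{3,2,2}` (the predicate below), or with no top letter, has exponent `< d₃ + 2d₂`
(window-ordered support). [folklore] -/
theorem sym_sum_lt_midTop (d : Fin 4 → ℕ) (hd : StrictMono d) (hwin : 3 * d 2 < d 3) (s : Sym (Fin 4) 3)
    (h : (3 : Fin 4) ∉ (s : Multiset (Fin 4)) ∨
      (Multiset.count (3 : Fin 4) (s : Multiset (Fin 4)) = 1 ∧ (s : Multiset (Fin 4)) ≠ {3, 2, 2})) :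
    ((s : Multiset (Fin 4)).map d).sum < d 3 + 2 * d 2 := by
  have h12 : d 1 < d 2 := hd (by decide)
  have hle2 : ∀ l : Fin 4, l ≠ 3 → d l ≤ d 2 := fun l hl => hd.monotone (by
    have : (l : ℕ) ≠ 3 := fun h => hl (Fin.ext h)
    have := l.2; show (l : ℕ) ≤ 2; omega)
  have hle1 : ∀ l : Fin 4, l ≠ 3 → l ≠ 2 → d l ≤ d 1 := fun l hl hl2 => hd.monotone (by
    have : (l : ℕ) ≠ 3 := fun h => hl (Fin.ext h)
    have : (l : ℕ) ≠ 2 := fun h => hl2 (Fin.ext h)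
    have := l.2; show (l : ℕ) ≤ 1; omega)
  rcases h with h | ⟨hc, hne⟩
  · have := sym_sum_le_core_of_top_not_mem d hd s h; omega
  · have hmem : (3 : Fin 4) ∈ (s : Multiset (Fin 4)) := Multiset.count_pos.mp (by omega)
    obtain ⟨t, ht⟩ := Multiset.exists_cons_of_mem hmem
    have hct : Multiset.card t = 2 := by
      have hcs : Multiset.card (s : Multiset (Fin 4)) = 3 := Sym.card_coe
      rw [ht, Multiset.card_cons] at hcs; omega
    have h3t : (3 : Fin 4) ∉ t := by
      intro h3t
      rw [ht, Multiset.count_cons_self] at hc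
      have := Multiset.count_pos.mpr h3t
      omega
    -- `t ≠ {2,2}`, else `s = {3,2,2}`
    obtain ⟨b, hb, hb2⟩ : ∃ b ∈ t, b ≠ 2 := by
      by_contra hall
      have ht22 : t = Multiset.replicate 2 2 :=
        Multiset.eq_replicate.2 ⟨hct, fun b hb => by
          by_contra hb2
          exact hall ⟨b, hb, hb2⟩⟩
      apply hne
      rw [ht, ht22]
      decide
    have hb3 : b ≠ 3 := fun h => h3t (h ▸ hb)
    obtain ⟨u, hu⟩ := Multiset.exists_cons_of_mem hb
    have hcu : Multiset.card u = 1 := by rw [hu, Multiset.card_cons] at hct; omega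
    have h3u : (3 : Fin 4) ∉ u := fun h => h3t (by rw [hu]; exact Multiset.mem_cons_of_mem h)
    have hsum : (u.map d).sum ≤ d 2 := by
      have h := Multiset.sum_le_card_nsmul (u.map d) (d 2) (by
        intro x hx
        obtain ⟨l, hl, rfl⟩ := Multiset.mem_map.mp hx
        exact hle2 l (fun h => h3u (h ▸ hl)))
      simpa [hcu] using h
    have hdb : d b ≤ d 1 := hle1 b hb3 hb2
    rw [ht, hu, Multiset.map_cons, Multiset.sum_cons, Multiset.map_cons, Multiset.sum_cons]; omega

/-- Conversely (window-ordered support): two top letters, or the slot `{3,2,2}`, give exponent `≥ d₃ + 2d₂`. [folklore] -/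
theorem sym_sum_ge_midTop (d : Fin 4 → ℕ) (hd : StrictMono d) (hwin : 3 * d 2 < d 3) (s : Sym (Fin 4) 3)
    (h : 2 ≤ Multiset.count (3 : Fin 4) (s : Multiset (Fin 4)) ∨ (s : Multiset (Fin 4)) = {3, 2, 2}) :
    d 3 + 2 * d 2 ≤ ((s : Multiset (Fin 4)).map d).sum := by
  rcases h with h | h
  · have := sym_sum_ge_of_two_tops d hd s h; omega
  · rw [h]
    simp only [Multiset.insert_eq_cons, Multiset.map_cons, Multiset.sum_cons, Multiset.map_singleton, Multiset.sum_singleton]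
    omega

/-! ## 2. Three more chamber-free sheet ranks -/

/-- The slots without the top letter other than `{2,2,2}`: `9` of them. [folklore] -/
theorem card_slots_core_below_top :
    (((Finset.univ : Finset (Sym (Fin 4) 3)).erase (Sym.replicate 3 3)).filter
      (fun s : Sym (Fin 4) 3 => (3 : Fin 4) ∉ (s : Multiset (Fin 4)) ∧ s ≠ Sym.replicate 3 2)).card = 9 := by
  decide

/-- The slots below the middle-window top `{3,2,2}`: `15` of them. [folklore] -/
theorem card_slots_below_midTop :
    (((Finset.univ : Finset (Sym (Fin 4) 3)).erase (Sym.replicate 3 3)).filter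
      (fun s : Sym (Fin 4) 3 => (3 : Fin 4) ∉ (s : Multiset (Fin 4)) ∨
        (Multiset.count (3 : Fin 4) (s : Multiset (Fin 4)) = 1 ∧ (s : Multiset (Fin 4)) ≠ {3, 2, 2}))).card = 15 := by
  decide

/-- **`ρ(3d₂) = 9`** on a window-ordered support (null-top eighteen). [folklore] -/
theorem sheetRank_coreTop_of_windowOrdered (d : Fin 4 → ℕ) (hd : StrictMono d) (hwin : 3 * d 2 < d 3) (S : Fin 4 → Matrix (Fin 3) (Fin 3) ℝ)
    (h3 : (S 3).det = 0)
    (h18 : 18 ≤ ((Matrix.det (∑ l, ((X : ℝ[X]) ^ d l) • (S l).map C)).roots.toFinset.filter (fun t => 0 < t)).card) :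
    ((Matrix.det (∑ l, ((X : ℝ[X]) ^ d l) • (S l).map C)).support.filter (· < 3 * d 2)).card = 9 := by
  classical
  have hinj := sym_sum_injOn_of_nullTop_eighteen d S h3 h18
  set E := (Finset.univ : Finset (Sym (Fin 4) 3)).erase (Sym.replicate 3 3) with hE
  set σ : Sym (Fin 4) 3 → ℕ := fun s => ((s : Multiset (Fin 4)).map d).sum with hσ
  have hfilt : (Matrix.det (∑ l, ((X : ℝ[X]) ^ d l) • (S l).map C)).support.filter (· < 3 * d 2)
      = (E.filter (fun s : Sym (Fin 4) 3 => (3 : Fin 4) ∉ (s : Multiset (Fin 4)) ∧ s ≠ Sym.replicate 3 2)).image σ := by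
    rw [support_det_pencil_eq_of_nullTop_eighteen d S h3 h18]
    ext c
    simp only [Finset.mem_filter, Finset.mem_image]
    constructor
    · rintro ⟨⟨s, hs, rfl⟩, hlt⟩
      refine ⟨s, ⟨hs, ?_, ?_⟩, rfl⟩
      · intro hmem
        have := sym_sum_ge_three_d2 d hd hwin s (Or.inl hmem)
        exact absurd hlt (not_lt.mpr this)
      · intro heq
        have := sym_sum_ge_three_d2 d hd hwin s (Or.inr heq)
        exact absurd hlt (not_lt.mpr this)
    · rintro ⟨s, ⟨hs, hnot, hne⟩, rfl⟩
      exact ⟨⟨s, hs, rfl⟩, sym_sum_lt_three_d2 d hd s hnot hne⟩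
  rw [hfilt, Finset.card_image_of_injOn (hinj.mono (by intro s hs; exact (Finset.mem_filter.mp hs).1))]
  exact card_slots_core_below_top

/-- **`ρ(d₃ + 2d₂) = 15`** on a window-ordered support (null-top eighteen). [folklore] -/
theorem sheetRank_midTop_of_windowOrdered (d : Fin 4 → ℕ) (hd : StrictMono d) (hwin : 3 * d 2 < d 3) (S : Fin 4 → Matrix (Fin 3) (Fin 3) ℝ)
    (h3 : (S 3).det = 0)
    (h18 : 18 ≤ ((Matrix.det (∑ l, ((X : ℝ[X]) ^ d l) • (S l).map C)).roots.toFinset.filter (fun t => 0 < t)).card) :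
    ((Matrix.det (∑ l, ((X : ℝ[X]) ^ d l) • (S l).map C)).support.filter (· < d 3 + 2 * d 2)).card = 15 := by
  classical
  have hinj := sym_sum_injOn_of_nullTop_eighteen d S h3 h18
  set E := (Finset.univ : Finset (Sym (Fin 4) 3)).erase (Sym.replicate 3 3) with hE
  set σ : Sym (Fin 4) 3 → ℕ := fun s => ((s : Multiset (Fin 4)).map d).sum with hσ
  have hfilt : (Matrix.det (∑ l, ((X : ℝ[X]) ^ d l) • (S l).map C)).support.filter (· < d 3 + 2 * d 2)
      = (E.filter (fun s : Sym (Fin 4) 3 => (3 : Fin 4) ∉ (s : Multiset (Fin 4)) ∨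
          (Multiset.count (3 : Fin 4) (s : Multiset (Fin 4)) = 1 ∧ (s : Multiset (Fin 4)) ≠ {3, 2, 2}))).image σ := by
    rw [support_det_pencil_eq_of_nullTop_eighteen d S h3 h18]
    ext c
    simp only [Finset.mem_filter, Finset.mem_image]
    constructor
    · rintro ⟨⟨s, hs, rfl⟩, hlt⟩
      refine ⟨s, ⟨hs, ?_⟩, rfl⟩
      by_cases hmem : (3 : Fin 4) ∈ (s : Multiset (Fin 4))
      · right
        have hc1 : 1 ≤ Multiset.count (3 : Fin 4) (s : Multiset (Fin 4)) := Multiset.count_pos.mpr hmem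
        refine ⟨?_, ?_⟩
        · by_contra hne
          have := sym_sum_ge_midTop d hd hwin s (Or.inl (by omega))
          exact absurd hlt (not_lt.mpr this)
        · intro heq
          have := sym_sum_ge_midTop d hd hwin s (Or.inr heq)
          exact absurd hlt (not_lt.mpr this)
      · left; exact hmem
    · rintro ⟨s, ⟨hs, hq⟩, rfl⟩
      exact ⟨⟨s, hs, rfl⟩, sym_sum_lt_midTop d hd hwin s hq⟩
  rw [hfilt, Finset.card_image_of_injOn (hinj.mono (by intro s hs; exact (Finset.mem_filter.mp hs).1))]
  exact card_slots_below_midTop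

/-- **`ρ(2d₃ + d₂) = 18`**: everything but the top slot lies below it (sorted support, null-top eighteen). [folklore] -/
theorem sheetRank_top_of_nullTop_eighteen (d : Fin 4 → ℕ) (hd : StrictMono d) (S : Fin 4 → Matrix (Fin 3) (Fin 3) ℝ) (h3 : (S 3).det = 0)
    (h18 : 18 ≤ ((Matrix.det (∑ l, ((X : ℝ[X]) ^ d l) • (S l).map C)).roots.toFinset.filter (fun t => 0 < t)).card) :
    ((Matrix.det (∑ l, ((X : ℝ[X]) ^ d l) • (S l).map C)).support.filter (· < 2 * d 3 + d 2)).card = 18 := by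
  classical
  have h332 : Multiset.card ({3, 3, 2} : Multiset (Fin 4)) = 3 := by simp
  set P := Matrix.det (∑ l, ((X : ℝ[X]) ^ d l) • (S l).map C) with hP
  have hsupp := support_det_pencil_eq_of_nullTop_eighteen d S h3 h18
  have hcard : P.support.card = 19 := by
    rw [hP, hsupp, Finset.card_image_iff.mpr (sym_sum_injOn_of_nullTop_eighteen d S h3 h18),
      Finset.card_erase_of_mem (Finset.mem_univ _), Finset.card_univ, Sym.card_sym_eq_choose]
    decide
  have hs2 : (⟨{3, 3, 2}, h332⟩ : Sym (Fin 4) 3) ≠ Sym.replicate 3 3 := sym_mk_ne_replicate h332 3 (by decide)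
  have hmem2 : 2 * d 3 + d 2 ∈ P.support := by
    rw [hP, hsupp]
    exact Finset.mem_image.mpr ⟨_, Finset.mem_erase.mpr ⟨hs2, Finset.mem_univ _⟩, sym_sum_332 d h332⟩
  have hfilt : P.support.filter (fun c => c < 2 * d 3 + d 2) = P.support.erase (2 * d 3 + d 2) := by
    ext c
    simp only [Finset.mem_filter, Finset.mem_erase]
    constructor
    · rintro ⟨hc, hlt⟩; exact ⟨Nat.ne_of_lt hlt, hc⟩
    · rintro ⟨hne, hc⟩
      refine ⟨hc, lt_of_le_of_ne ?_ hne⟩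
      rw [hP, hsupp] at hc
      obtain ⟨s, hs, rfl⟩ := Finset.mem_image.mp hc
      exact sym_sum_le_subtop_of_strictMono d hd s (Finset.mem_erase.mp hs).1
  rw [hfilt, Finset.card_erase_of_mem hmem2, hcard]

/-! ## 3. The law: semidefinite top cell ⇒ non-definite third letter -/

/-- **WINDOW-ORDERED SUPPORTS, SEMIDEFINITE ADJUGATE CELL ⇒ NON-DEFINITE THIRD LETTER.**  On a sorted support with `3·d 2 < d 3`, a pencil with `det S₃ = 0`,
`adj S₃ ⪰ 0` and a DEFINITE third letter `S₂` has at most `17` distinct positive roots. [folklore] -/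
theorem card_posRoots_le_17_of_windowOrdered_semidefTop_definiteThird (d : Fin 4 → ℕ) (hd : StrictMono d) (hwin : 3 * d 2 < d 3)
    (S : Fin 4 → Matrix (Fin 3) (Fin 3) ℝ) (h3 : (S 3).det = 0) (hcell : (S 3).adjugate.PosSemidef) (h2 : (S 2).PosDef ∨ (-S 2).PosDef) :
    ((Matrix.det (∑ l, ((X : ℝ[X]) ^ d l) • (S l).map C)).roots.toFinset.filter (fun t => 0 < t)).card ≤ 17 := by
  by_contra hlt
  have h18 : 18 ≤ ((Matrix.det (∑ l, ((X : ℝ[X]) ^ d l) • (S l).map C)).roots.toFinset.filter (fun t => 0 < t)).card := by omega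
  set ρ : ℕ → ℕ := fun e => ((Matrix.det (∑ l, ((X : ℝ[X]) ^ d l) • (S l).map C)).support.filter (· < e)).card with hρ
  obtain ⟨t0, -⟩ := top_test_of_nullTop_eighteen d hd S h3 (by decide : (2 : Fin 4) ≠ 3) h2 h18 ρ (fun e => rfl)
  have w := t0 hcell
  have r0 : ρ (3 * d 2) = 9 := sheetRank_coreTop_of_windowOrdered d hd hwin S h3 h18
  have r1 : ρ (2 * d 2 + d 3) = 15 := by
    rw [show 2 * d 2 + d 3 = d 3 + 2 * d 2 by ring]; exact sheetRank_midTop_of_windowOrdered d hd hwin S h3 h18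
  have r2 : ρ (2 * d 3 + d 2) = 18 := sheetRank_top_of_nullTop_eighteen d hd S h3 h18
  rw [r0, r1, r2] at w
  norm_num at w

/-- The same with the cell read off the LETTER: `S₃ ⪰ 0` or `S₃ ⪯ 0` (semidefinite inertia cell of the singular top letter). [folklore] -/
theorem card_posRoots_le_17_of_windowOrdered_semidefLetter_definiteThird (d : Fin 4 → ℕ) (hd : StrictMono d) (hwin : 3 * d 2 < d 3)
    (S : Fin 4 → Matrix (Fin 3) (Fin 3) ℝ) (h3 : (S 3).det = 0) (hcell : (S 3).PosSemidef ∨ (-(S 3)).PosSemidef)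
    (h2 : (S 2).PosDef ∨ (-S 2).PosDef) :
    ((Matrix.det (∑ l, ((X : ℝ[X]) ^ d l) • (S l).map C)).roots.toFinset.filter (fun t => 0 < t)).card ≤ 17 :=
  card_posRoots_le_17_of_windowOrdered_semidefTop_definiteThird d hd hwin S h3 (adjugate_posSemidef_of_semidef_cell hcell) h2

end Summit.ValiantsHypothesis.ValiantsHypothesis.Theorems.LacunarySymmetroidMatrixDescartes.Census
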